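import Literature.MathematicalPhysics.QuantumFieldTheory.Balaban1983to89.B13GaussParamHolomorphic

/-!
# `Balaban1983to89.B13Core214Holomorphic` — T. Bałaban, *Renormalization group approach to lattice gauge field
theories. II. Cluster expansions*, Commun. Math. Phys. **116** (1988) 1–22 [Balaban1988RG2Cluster], p. 15: the
`X`-integral of the display (2.14) IS *"an analytic function … of the complex parameters σ(Z), τ"* — DERIVED from
primitive data (entrywise holomorphy of the operator families + the (2.15)–(2.23) letters), discharging in kind the
regularity hypothesis `B13Term214.SepHolOn` of the tree's (2.14) chain

statement-level skeleton of published theorems with citation tags; proofs where landed; nothing here is a claim about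
the Yang–Mills mass gap

CITATION HEADER (verbatim).  P. 15 [PDF 15]: *"To get a bound for H(Z) we consider a term in the sum over 𝐃, P. This
term can be written in the following form: (2.14) … We consider it as an analytic function … of the complex parameters
σ(Z), τ, and we estimate it using the Cauchy formula"*; pp. 15–17: the estimates (2.15)–(2.25) (typed in the tree as
`B13FirstEstimate215`, `B13Replacement223`, `B13Integral223`).

WHAT IS PROVED HERE (cell `pub-balaban-gaps`, seat ne5 gen 6).  In the tree the printed analyticity is the HYPOTHESIS
`SepHolOn` — `hΨσ`, `hΨτ` of `B13Term214.term214_eq_DopC`, `B13Representation214.H28_eq_term214`,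
`B13Lemma3TorusPrimitive.h226_torus_of_primitives` (*"analyticity: LOCATED-ROUTINE given the objects"*,
`B13Lemma3TorusSocket`).  Over the block model of record and for operator families `A(p)` (= `C^{(k)}(Z₀,σ)⁻¹`),
`Γ(p)` (= `Γ_k(Z₀,σ)`) and last line `F(p, ·)` depending on a parameter `p` of ANY complex normed space `P`:
* §1 `differentiableOn_innerMean` — the inner complex Gaussian mean `∫dμ_{A(p)⁻¹}(B) e^{−⟨B,Γ(p)X⟩}F(p,B)` of (2.14) is
  holomorphic in `p` at every white noise `X`, the domination being the `B`-majorant of (2.15)–(2.23)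
  (`B13Integral223.integrable_weight_mul_integrand` at `α = 2ρ + a`) under the letters `R₂` ((2.16)∕(2.21)), `R₃`, the
  Gaussian growth `‖F‖ ≤ Ke^{½a‖B‖²}` ((2.20) + (2.22)) and `(2ρ + a)λ_max(C) < 1`, UNIFORMLY on the parameter set;
* §2 `differentiableOn_integrand214` — lines 2–3 of (2.14) (`B13Term214.integrand214`) are holomorphic in `p` at every
  `X` (§1 × the prefactor `exp(−½⟨Γ(p)X, A(p)⁻¹Γ(p)X⟩)`, inverse entries by `B13CovarianceDifference216` §3);
* §3 `differentiableOn_core214X` — THE `X`-INTEGRAL `∫dμ₀(X)|_Z (lines 2–4)` (`cgaussMean 1 (integrand214 …)`, the value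
  of `B13Term214.core214`) is holomorphic in `p` on the open parameter set: holomorphy under the integral sign
  (`B13GaussParamHolomorphic.differentiableOn_cgaussMean_of_dominated`) with the `X`-majorant of (2.15) → (2.23)
  (`norm_integrand214_le_215` → `integrand215_replace_le` → `integrable_integrand223`, BY NAME) under the remaining
  letters `R₁`, (2.17) (twice), `λ_k(C) ≤ c`, `α₅c ≤ ½`, `⟨Γ₀X, CΓ₀X⟩ ≤ g‖X‖²`, `α₅(1 + 2cg) < 1`, all uniform in `p`;
* §4 `sepHolOn_of_differentiableOn_pi`, `sepHolOn_core214_sigma`, `sepHolOn_core214_tau` — the tree's separate-holomorphy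
  class on a polydisc follows: the σ-slot `hΨσ` (last line fixed) and the τ-slot `hΨτ` (operators fixed, last line =
  the printed `F214`, τ-entire by `differentiableOn_F214`, Gaussian growth by `B13Integral223.norm_F214_le`).
ONE HONEST EXTRA HYPOTHESIS relative to the (2.15) bounds: measurability of `B ↦ F(p, B)` (the norm bounds of the tree
never needed it — `‖∫‖ ≤ ∫` majorant holds for any integrand; holomorphy of the integral does).

HONEST FRAMING.  Generic finite-dimensional complex analysis over the block model; the operator families and every
letter are HYPOTHESES uniform on the parameter set; nothing of Bałaban's `Γ_k(Z₀,σ)`, `C^{(k)}(Z₀,σ)`, their walk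
expansions or k-dependence is constructed or asserted; (D4) instance 0∕1, T⁴ spine 0∕9 UNCHANGED; NOT continuum, NOT
infinite volume, NOT mass gap, NOT Clay.  Consumers: the σ∕τ slots above; row NE5's H-layer datum along the two-run
data pencil (`P = E × ℂ`, entries from `B13JointWalkExpansion.JointWalkExpansion.analyticOnBall`).  0 sorry, 0 `def`.
-/

noncomputable section

namespace Literature.MathematicalPhysics.QuantumFieldTheory.Balaban1983to89.B13Core214Holomorphic

open Matrix MeasureTheory Finset Complex Metric Set
open scoped Real
open B13GaugeDevices (gaussWeight gaussInt gaussNorm gaussMean)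
open B2Eq228Conditioning (gaussNorm_pos integrable_gaussWeight)
open B13Term214 (cquad cgaussWeight cgaussInt cgaussNorm cgaussMean integrand214 core214 F214 SepHolOn)
open B13Integral223 (innerB posDef_inv_sub_smul integrable_weight_mul_integrand dotProduct_self_nonneg')
open B13FirstEstimate215 (cgaussNorm_ne_zero norm_cgaussWeight_eq_gaussWeight norm_integrand214_le_215
  norm_cexp_neg_dotProduct)
open B13Replacement223 (integrand215_replace_le integrable_hg215_gauss integrable_integrand223)
open B13CovarianceDifference216 (differentiableOn_matrix_inv)
open B13GaussParamHolomorphic (differentiableOn_dotProduct det_ne_zero_of_re_posDef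
  differentiableOn_cgaussMean_of_dominated continuous_cgaussWeight)

variable {Λ C₀ : Type} [Fintype Λ] [DecidableEq Λ] [Fintype C₀] [DecidableEq C₀]
variable {P : Type*} [NormedAddCommGroup P] [NormedSpace ℂ P] {V : Set P}
variable {A : P → Matrix Λ Λ ℂ} {Γ : P → (Λ ⊕ C₀ → ℝ) → (Λ → ℂ)} {F : P → (Λ → ℝ) → ℂ}
variable {C : Matrix Λ Λ ℝ} {Γ₀ : Matrix Λ (Λ ⊕ C₀) ℝ} {ρ a K c g η : ℝ}

/-! ## §1. The inner complex Gaussian mean of (2.14) is holomorphic in the parameter -/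

/-- `R₂`-domination of the weight: `⟨B,(C⁻¹ − Re A)B⟩ ≤ ρ‖B‖²` ⟹ `⟨B,(C⁻¹ − ρI)B⟩ ≤ ⟨B, Re A B⟩`.
[cite: Balaban1988RG2Cluster, (2.16)–(2.17) p.16] (elementary API for (2.15)) -/
theorem inv_sub_smul_form_le {A' : Matrix Λ Λ ℂ} {ρ' : ℝ}
    (hR2 : ∀ B : Λ → ℝ, B ⬝ᵥ ((C⁻¹ - A'.map Complex.re) *ᵥ B) ≤ ρ' * (B ⬝ᵥ B)) (B : Λ → ℝ) :
    B ⬝ᵥ ((C⁻¹ - ρ' • (1 : Matrix Λ Λ ℝ)) *ᵥ B) ≤ B ⬝ᵥ (A'.map Complex.re *ᵥ B) := by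
  have h := hR2 B
  rw [sub_mulVec, dotProduct_sub] at h ⊢
  rw [smul_mulVec, one_mulVec, dotProduct_smul, smul_eq_mul]
  linarith

omit [DecidableEq C₀] [NormedAddCommGroup P] [NormedSpace ℂ P] in
/-- **The `B`-integrand of the inner mean is dominated, uniformly in the parameter, by the integrable `B`-integrand of
(2.23)** (times `K e^{½ρ‖X‖²}`): `‖e^{−½⟨B,A(p)B⟩}·e^{−⟨B,Γ(p)X⟩}F(p,B)‖ ≤ K e^{½ρ‖X‖²}·e^{−½⟨B,C⁻¹B⟩}e^{−⟨B,Γ₀X⟩+½(2ρ+a)‖B‖²}`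
from `R₂`, `R₃` and the Gaussian growth of `F`. [cite: Balaban1988RG2Cluster, (2.15) p.15, (2.16)–(2.21) p.16, (2.23) p.17] -/
theorem norm_innerIntegrand_le {p : P}
    (hR2 : ∀ B : Λ → ℝ, B ⬝ᵥ ((C⁻¹ - (A p).map Complex.re) *ᵥ B) ≤ ρ * (B ⬝ᵥ B))
    (hR3 : ∀ (X : Λ ⊕ C₀ → ℝ) (B : Λ → ℝ), -(B ⬝ᵥ fun i => (Γ p X i).re)
      ≤ -(B ⬝ᵥ (Γ₀ *ᵥ X)) + ρ / 2 * (X ⬝ᵥ X + B ⬝ᵥ B))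
    (hF : ∀ B, ‖F p B‖ ≤ K * Real.exp (a / 2 * (B ⬝ᵥ B))) (X : Λ ⊕ C₀ → ℝ) (B : Λ → ℝ) :
    ‖cgaussWeight (A p) B * (Complex.exp (-((fun i => (B i : ℂ)) ⬝ᵥ Γ p X)) * F p B)‖
      ≤ K * Real.exp (ρ / 2 * (X ⬝ᵥ X)) *
        (gaussWeight C⁻¹ B * Real.exp (-(B ⬝ᵥ (Γ₀ *ᵥ X)) + (2 * ρ + a) / 2 * (B ⬝ᵥ B))) := by
  rw [norm_mul, norm_mul, norm_cexp_neg_dotProduct]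
  have h1 : ‖cgaussWeight (A p) B‖ ≤ gaussWeight C⁻¹ B * Real.exp (ρ / 2 * (B ⬝ᵥ B)) := by
    rw [norm_cgaussWeight_eq_gaussWeight, gaussWeight, gaussWeight, ← Real.exp_add]
    refine Real.exp_le_exp.2 ?_
    have h := hR2 B
    rw [sub_mulVec, dotProduct_sub] at h
    linarith
  have h2 : Real.exp (-(B ⬝ᵥ fun i => (Γ p X i).re)) ≤ Real.exp (-(B ⬝ᵥ (Γ₀ *ᵥ X)) + ρ / 2 * (X ⬝ᵥ X + B ⬝ᵥ B)) :=
    Real.exp_le_exp.2 (hR3 X B)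
  calc ‖cgaussWeight (A p) B‖ * (Real.exp (-(B ⬝ᵥ fun i => (Γ p X i).re)) * ‖F p B‖)
      ≤ (gaussWeight C⁻¹ B * Real.exp (ρ / 2 * (B ⬝ᵥ B))) *
          (Real.exp (-(B ⬝ᵥ (Γ₀ *ᵥ X)) + ρ / 2 * (X ⬝ᵥ X + B ⬝ᵥ B)) * (K * Real.exp (a / 2 * (B ⬝ᵥ B)))) :=
        mul_le_mul h1 (mul_le_mul h2 (hF B) (norm_nonneg _) (Real.exp_pos _).le)
          (mul_nonneg (Real.exp_pos _).le (norm_nonneg _)) (mul_nonneg (Real.exp_pos _).le (Real.exp_pos _).le)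
    _ = K * Real.exp (ρ / 2 * (X ⬝ᵥ X)) *
          (gaussWeight C⁻¹ B * Real.exp (-(B ⬝ᵥ (Γ₀ *ᵥ X)) + (2 * ρ + a) / 2 * (B ⬝ᵥ B))) := by
        have e : Real.exp (-(B ⬝ᵥ (Γ₀ *ᵥ X)) + (2 * ρ + a) / 2 * (B ⬝ᵥ B))
            = Real.exp (ρ / 2 * (B ⬝ᵥ B)) * Real.exp (-(B ⬝ᵥ (Γ₀ *ᵥ X)) + ρ / 2 * (X ⬝ᵥ X + B ⬝ᵥ B))
              * Real.exp (a / 2 * (B ⬝ᵥ B)) * (Real.exp (ρ / 2 * (X ⬝ᵥ X)))⁻¹ := by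
          rw [← Real.exp_add, ← Real.exp_add, ← Real.exp_neg, ← Real.exp_add]
          congr 1; ring
        rw [e]
        field_simp

omit [DecidableEq C₀] in
/-- **THE INNER MEAN `∫dμ_{A(p)⁻¹}(B) e^{−⟨B,Γ(p)X⟩}F(p,B)` OF (2.14) IS HOLOMORPHIC IN THE PARAMETER** at every `X`: the
entries of `A`, of `Γ(·)X` and `F(·, B)` holomorphic on an open `V`; `A(p)` symmetric with `Re A(p) ≻ 0`; `F(p, ·)`
measurable; and, uniformly on `V`, the letters `R₂` (`⟨B,(C⁻¹ − Re A(p))B⟩ ≤ ρ‖B‖²`), `R₃`, `‖F(p,B)‖ ≤ Ke^{½a‖B‖²}`,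
`λ_k(C) ≤ c`, `(2ρ + a)c < 1`. [cite: Balaban1988RG2Cluster, (2.14)–(2.15) p.15, (2.16)–(2.21) p.16, (2.23) p.17] -/
theorem differentiableOn_innerMean (hV : IsOpen V) (hA : ∀ i j, DifferentiableOn ℂ (fun p => A p i j) V)
    (hAs : ∀ p ∈ V, (A p).IsSymm) (hApos : ∀ p ∈ V, ((A p).map Complex.re).PosDef)
    (hΓd : ∀ (X : Λ ⊕ C₀ → ℝ) (i : Λ), DifferentiableOn ℂ (fun p => Γ p X i) V)
    (hFd : ∀ B, DifferentiableOn ℂ (fun p => F p B) V) (hFm : ∀ p ∈ V, StronglyMeasurable (F p))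
    (hC : C.PosDef) (hρ0 : 0 ≤ ρ) (ha0 : 0 ≤ a)
    (hR2 : ∀ p ∈ V, ∀ B : Λ → ℝ, B ⬝ᵥ ((C⁻¹ - (A p).map Complex.re) *ᵥ B) ≤ ρ * (B ⬝ᵥ B))
    (hR3 : ∀ p ∈ V, ∀ (X : Λ ⊕ C₀ → ℝ) (B : Λ → ℝ), -(B ⬝ᵥ fun i => (Γ p X i).re)
      ≤ -(B ⬝ᵥ (Γ₀ *ᵥ X)) + ρ / 2 * (X ⬝ᵥ X + B ⬝ᵥ B))
    (hF : ∀ p ∈ V, ∀ B, ‖F p B‖ ≤ K * Real.exp (a / 2 * (B ⬝ᵥ B)))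
    (hc : ∀ k, hC.1.eigenvalues k ≤ c) (hsm : (2 * ρ + a) * c < 1) (X : Λ ⊕ C₀ → ℝ) :
    DifferentiableOn ℂ (fun p => cgaussMean (A p)
      (fun B => Complex.exp (-((fun i => (B i : ℂ)) ⬝ᵥ Γ p X)) * F p B)) V := by
  -- the fixed real precision below every `Re A(p)`
  have hρc : ρ * c < 1 := by
    rcases le_or_gt 0 c with hc0 | hc0
    · nlinarith
    · nlinarith
  have hM : (C⁻¹ - ρ • (1 : Matrix Λ Λ ℝ)).PosDef := posDef_inv_sub_smul hC hc hρc
  have hα : (C⁻¹ - (2 * ρ + a) • (1 : Matrix Λ Λ ℝ)).PosDef := posDef_inv_sub_smul hC hc hsm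
  refine differentiableOn_cgaussMean_of_dominated hV hA hAs hApos hM
    (fun p hp B => inv_sub_smul_form_le (hR2 p hp) B) (fun B => ?_) (fun p hp => ?_)
    (((integrable_weight_mul_integrand hC hα (Γ₀ *ᵥ X)).const_mul (K * Real.exp (ρ / 2 * (X ⬝ᵥ X)))))
    (fun p hp B => norm_innerIntegrand_le (hR2 p hp) (hR3 p hp) (hF p hp) X B)
  · -- holomorphy of the integrand at fixed B
    have hdot : DifferentiableOn ℂ (fun p => (fun i => (B i : ℂ)) ⬝ᵥ Γ p X) V :=
      differentiableOn_dotProduct (fun i => differentiableOn_const _) (hΓd X)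
    exact hdot.neg.cexp.mul (hFd B)
  · -- measurability in B at fixed p
    have hcont : Continuous fun B : Λ → ℝ => Complex.exp (-((fun i => (B i : ℂ)) ⬝ᵥ Γ p X)) := by
      unfold dotProduct; fun_prop
    exact (hcont.stronglyMeasurable.mul (hFm p hp)).aestronglyMeasurable


/-! ## §2. Lines 2–3 of (2.14) are holomorphic in the parameter at every white noise `X` -/

omit [DecidableEq C₀] in
/-- **`integrand214 (A p) (Γ p) (F p) X` is holomorphic in `p`**: the prefactor `exp(−½⟨Γ(p)X, A(p)⁻¹Γ(p)X⟩)` (inverse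
entries holomorphic where `det A(p) ≠ 0` — `B13CovarianceDifference216.differentiableOn_matrix_inv` — which `Re A(p) ≻ 0` guarantees) times the inner mean of §1.
[cite: Balaban1988RG2Cluster, (2.14)–(2.15) p.15, (2.16)–(2.21) p.16, (2.23) p.17] -/
theorem differentiableOn_integrand214 (hV : IsOpen V) (hA : ∀ i j, DifferentiableOn ℂ (fun p => A p i j) V)
    (hAs : ∀ p ∈ V, (A p).IsSymm) (hApos : ∀ p ∈ V, ((A p).map Complex.re).PosDef)
    (hΓd : ∀ (X : Λ ⊕ C₀ → ℝ) (i : Λ), DifferentiableOn ℂ (fun p => Γ p X i) V)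
    (hFd : ∀ B, DifferentiableOn ℂ (fun p => F p B) V) (hFm : ∀ p ∈ V, StronglyMeasurable (F p))
    (hC : C.PosDef) (hρ0 : 0 ≤ ρ) (ha0 : 0 ≤ a)
    (hR2 : ∀ p ∈ V, ∀ B : Λ → ℝ, B ⬝ᵥ ((C⁻¹ - (A p).map Complex.re) *ᵥ B) ≤ ρ * (B ⬝ᵥ B))
    (hR3 : ∀ p ∈ V, ∀ (X : Λ ⊕ C₀ → ℝ) (B : Λ → ℝ), -(B ⬝ᵥ fun i => (Γ p X i).re)
      ≤ -(B ⬝ᵥ (Γ₀ *ᵥ X)) + ρ / 2 * (X ⬝ᵥ X + B ⬝ᵥ B))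
    (hF : ∀ p ∈ V, ∀ B, ‖F p B‖ ≤ K * Real.exp (a / 2 * (B ⬝ᵥ B)))
    (hc : ∀ k, hC.1.eigenvalues k ≤ c) (hsm : (2 * ρ + a) * c < 1) (X : Λ ⊕ C₀ → ℝ) :
    DifferentiableOn ℂ (fun p => integrand214 (A p) (Γ p) (F p) X) V := by
  have hdet : ∀ p ∈ V, (A p).det ≠ 0 := fun p hp => det_ne_zero_of_re_posDef (hAs p hp) (hApos p hp)
  have hinv : ∀ i j, DifferentiableOn ℂ (fun p => (A p)⁻¹ i j) V := differentiableOn_matrix_inv hA hdet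
  have hmv : ∀ i, DifferentiableOn ℂ (fun p => ((A p)⁻¹ *ᵥ Γ p X) i) V := fun i =>
    differentiableOn_dotProduct (fun j => hinv i j) (hΓd X)
  have hq : DifferentiableOn ℂ (fun p => Γ p X ⬝ᵥ ((A p)⁻¹ *ᵥ Γ p X)) V := differentiableOn_dotProduct (hΓd X) hmv
  unfold integrand214
  exact ((differentiableOn_const _).mul hq).cexp.mul
    (differentiableOn_innerMean hV hA hAs hApos hΓd hFd hFm hC hρ0 ha0 hR2 hR3 hF hc hsm X)

/-! ## §3. The `X`-integral of (2.14) is holomorphic in the parameter -/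

omit [DecidableEq C₀] in
/-- The `X`-integrand of (2.14) is a.e.-strongly measurable in the white noise at every parameter point: continuous
prefactor × (normalisation)⁻¹ × a parametric Bochner integral of a jointly measurable integrand
(`MeasureTheory.StronglyMeasurable.integral_prod_right`). [cite: Balaban1988RG2Cluster, (2.14)–(2.15) p.15] (elementary API for (2.14)) -/
theorem aestronglyMeasurable_integrand214 {A' : Matrix Λ Λ ℂ} {Γ' : (Λ ⊕ C₀ → ℝ) → (Λ → ℂ)} (hΓc : Continuous Γ')
    {F' : (Λ → ℝ) → ℂ} (hFm : StronglyMeasurable F') :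
    AEStronglyMeasurable (fun X => integrand214 A' Γ' F' X) volume := by
  have h1 : Continuous fun X : Λ ⊕ C₀ → ℝ => Complex.exp (-(1 / 2 : ℂ) * (Γ' X ⬝ᵥ (A'⁻¹ *ᵥ Γ' X))) := by
    unfold dotProduct Matrix.mulVec; fun_prop
  have hc : Continuous fun q : (Λ ⊕ C₀ → ℝ) × (Λ → ℝ) =>
      cgaussWeight A' q.2 * Complex.exp (-((fun i => (q.2 i : ℂ)) ⬝ᵥ Γ' q.1)) := by
    refine ((continuous_cgaussWeight A').comp continuous_snd).mul ?_
    unfold dotProduct; fun_prop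
  have hF2 : StronglyMeasurable fun q : (Λ ⊕ C₀ → ℝ) × (Λ → ℝ) => F' q.2 :=
    hFm.comp_measurable measurable_snd
  have h2 : StronglyMeasurable (Function.uncurry fun (X : Λ ⊕ C₀ → ℝ) (B : Λ → ℝ) =>
      cgaussWeight A' B * (Complex.exp (-((fun i => (B i : ℂ)) ⬝ᵥ Γ' X)) * F' B)) := by
    have e : (Function.uncurry fun (X : Λ ⊕ C₀ → ℝ) (B : Λ → ℝ) =>
        cgaussWeight A' B * (Complex.exp (-((fun i => (B i : ℂ)) ⬝ᵥ Γ' X)) * F' B))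
        = fun q => (cgaussWeight A' q.2 * Complex.exp (-((fun i => (q.2 i : ℂ)) ⬝ᵥ Γ' q.1))) * F' q.2 := by
      funext q; simp only [Function.uncurry, mul_assoc]
    rw [e]; exact hc.stronglyMeasurable.mul hF2
  have h3 := h2.integral_prod_right (ν := (volume : Measure (Λ → ℝ)))
  show AEStronglyMeasurable (fun X => Complex.exp (-(1 / 2 : ℂ) * (Γ' X ⬝ᵥ (A'⁻¹ *ᵥ Γ' X))) *
    ((cgaussNorm A')⁻¹ * ∫ B, cgaussWeight A' B * (Complex.exp (-((fun i => (B i : ℂ)) ⬝ᵥ Γ' X)) * F' B))) volume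
  exact (h1.stronglyMeasurable.mul (stronglyMeasurable_const.mul h3)).aestronglyMeasurable

/-- `(1 : Matrix n n ℂ).map re = 1`. [folklore] -/
private theorem map_re_one {n : Type} [DecidableEq n] [Fintype n] :
    (1 : Matrix n n ℂ).map Complex.re = (1 : Matrix n n ℝ) :=
  Matrix.map_one Complex.re Complex.zero_re Complex.one_re

/-- **THE `X`-INTEGRAL OF (2.14) IS HOLOMORPHIC IN THE PARAMETER.**  Data: operator families `A`, `Γ` and last line
`F` over a parameter set `V` (open, in any complex normed space), entrywise holomorphic (`hA`, `hΓd`, `hFd`), `A(p)`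
symmetric with `Re A(p) ≻ 0`, `Γ(p)` continuous in `X`, `F(p, ·)` measurable; and the letters of the tree's
(2.15) → (2.23) passage UNIFORM in `p ∈ V`: `R₁` (`hR1`), (2.17) twice (`h17a`, `h17b`), `R₂` (`hR2`), `R₃` (`hR3`), the
Gaussian growth of the last line (`hF`, (2.20) + (2.22)), `λ_k(C) ≤ c`, `α₅c ≤ ½`, `⟨Γ₀X, CΓ₀X⟩ ≤ g‖X‖²`,
`α₅(1 + 2cg) < 1` with `α₅ = 2ρ + a`.  Conclusion: `p ↦ ∫dμ₀(X)|_Z (lines 2–4 of (2.14))`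
(= `cgaussMean 1 (integrand214 (A p) (Γ p) (F p))`, the value of `B13Term214.core214`) is `DifferentiableOn ℂ` on `V`
— holomorphy under the integral sign with the integrable `X`-majorant `e^{2η|Λ|}K·`[integrand of (2.23)]
(`norm_integrand214_le_215` → `integrand215_replace_le` → `integrable_integrand223`, by name).
[cite: Balaban1988RG2Cluster, (2.14)–(2.15) p.15, (2.16)–(2.22) p.16, (2.23)–(2.25) p.17] -/
theorem differentiableOn_core214X (hV : IsOpen V) (hA : ∀ i j, DifferentiableOn ℂ (fun p => A p i j) V)
    (hAs : ∀ p ∈ V, (A p).IsSymm) (hApos : ∀ p ∈ V, ((A p).map Complex.re).PosDef)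
    (hΓd : ∀ (X : Λ ⊕ C₀ → ℝ) (i : Λ), DifferentiableOn ℂ (fun p => Γ p X i) V)
    (hΓc : ∀ p ∈ V, Continuous (Γ p))
    (hFd : ∀ B, DifferentiableOn ℂ (fun p => F p B) V) (hFm : ∀ p ∈ V, StronglyMeasurable (F p))
    (hC : C.PosDef) (hρ0 : 0 ≤ ρ) (ha0 : 0 ≤ a) (hK : 0 ≤ K)
    (hR1 : ∀ p ∈ V, ∀ X : Λ ⊕ C₀ → ℝ, -(1 / 2) * ((Γ p X) ⬝ᵥ ((A p)⁻¹ *ᵥ Γ p X)).re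
      ≤ -(1 / 2 * ((Γ₀ *ᵥ X) ⬝ᵥ (C *ᵥ (Γ₀ *ᵥ X)))) + ρ / 2 * (X ⬝ᵥ X))
    (h17a : ∀ p ∈ V, Real.sqrt (‖(A p).det‖ / ((A p).map Complex.re).det) ≤ Real.exp (η * Fintype.card Λ))
    (h17b : ∀ p ∈ V, Real.sqrt (((A p).map Complex.re).det / C⁻¹.det) ≤ Real.exp (η * Fintype.card Λ))
    (hR2 : ∀ p ∈ V, ∀ B : Λ → ℝ, B ⬝ᵥ ((C⁻¹ - (A p).map Complex.re) *ᵥ B) ≤ ρ * (B ⬝ᵥ B))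
    (hR3 : ∀ p ∈ V, ∀ (X : Λ ⊕ C₀ → ℝ) (B : Λ → ℝ), -(B ⬝ᵥ fun i => (Γ p X i).re)
      ≤ -(B ⬝ᵥ (Γ₀ *ᵥ X)) + ρ / 2 * (X ⬝ᵥ X + B ⬝ᵥ B))
    (hF : ∀ p ∈ V, ∀ B, ‖F p B‖ ≤ K * Real.exp (a / 2 * (B ⬝ᵥ B)))
    (hc0 : 0 ≤ c) (hc : ∀ k, hC.1.eigenvalues k ≤ c) (hαc : (2 * ρ + a) * c ≤ 1 / 2)
    (hΓ0 : ∀ X : Λ ⊕ C₀ → ℝ, (Γ₀ *ᵥ X) ⬝ᵥ (C *ᵥ (Γ₀ *ᵥ X)) ≤ g * (X ⬝ᵥ X))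
    (hsmall : (2 * ρ + a) * (1 + 2 * c * g) < 1) :
    DifferentiableOn ℂ (fun p => cgaussMean (1 : Matrix (Λ ⊕ C₀) (Λ ⊕ C₀) ℂ) (integrand214 (A p) (Γ p) (F p))) V := by
  have hα0 : 0 ≤ 2 * ρ + a := by linarith
  have hsm : (2 * ρ + a) * c < 1 := by linarith
  have hρac : (ρ + a) * c < 1 := by nlinarith
  have hα : (C⁻¹ - (2 * ρ + a) • (1 : Matrix Λ Λ ℝ)).PosDef := posDef_inv_sub_smul hC hc hsm
  have h1re : ((1 : Matrix (Λ ⊕ C₀) (Λ ⊕ C₀) ℂ).map Complex.re).PosDef := by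
    rw [map_re_one]; exact Matrix.PosDef.one
  -- the X-majorant: e^{2η|Λ|}·K · (gaussian weight × integrand of (2.23))
  have hbound := (integrable_integrand223 hC Γ₀ hα0 hc0 hc hαc hΓ0 hsmall).const_mul
    (Real.exp (2 * η * Fintype.card Λ) * K)
  refine differentiableOn_cgaussMean_of_dominated hV (A := fun _ => (1 : Matrix (Λ ⊕ C₀) (Λ ⊕ C₀) ℂ))
    (fun i j => differentiableOn_const _) (fun p _ => Matrix.isSymm_one) (fun p _ => h1re) Matrix.PosDef.one
    (fun p _ X => by rw [map_re_one]) (fun X => ?_) (fun p hp => ?_) hbound (fun p hp X => ?_)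
  · exact differentiableOn_integrand214 hV hA hAs hApos hΓd hFd hFm hC hρ0 ha0 hR2 hR3 hF hc hsm X
  · exact aestronglyMeasurable_integrand214 (hΓc p hp) (hFm p hp)
  · -- domination: ‖e^{−½‖X‖²}·integrand214‖ ≤ e^{−½‖X‖²}·(2.15)-majorant ≤ e^{2η|Λ|}K·(2.23)-integrand
    have hg := integrable_hg215_gauss (A := A p) hC K (hR2 p hp) hc hρac (Γ p X)
    have h215 := norm_integrand214_le_215 (hAs p hp) (hApos p hp) (Γ p) (F p)
      (fun B => K * Real.exp (a / 2 * (B ⬝ᵥ B))) (hF p hp) X hg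
    have hrep := integrand215_replace_le (hApos p hp) hC (Γ p) Γ₀ ha0 hK (hR1 p hp) (h17a p hp) (h17b p hp)
      (hR2 p hp) (hR3 p hp) (fun B => K * Real.exp (a / 2 * (B ⬝ᵥ B))) (fun B => by positivity) (fun B => le_rfl) hα X
    rw [norm_mul, norm_cgaussWeight_eq_gaussWeight, map_re_one]
    calc gaussWeight (1 : Matrix (Λ ⊕ C₀) (Λ ⊕ C₀) ℝ) X * ‖integrand214 (A p) (Γ p) (F p) X‖
        ≤ gaussWeight (1 : Matrix (Λ ⊕ C₀) (Λ ⊕ C₀) ℝ) X * (Real.exp (2 * η * Fintype.card Λ) * K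
            * (Real.exp (-(1 / 2 * ((Γ₀ *ᵥ X) ⬝ᵥ (C *ᵥ (Γ₀ *ᵥ X)))) + (2 * ρ + a) / 2 * (X ⬝ᵥ X))
              * innerB C (2 * ρ + a) (Γ₀ *ᵥ X))) :=
          mul_le_mul_of_nonneg_left (h215.trans hrep) (B2Eq228Conditioning.gaussWeight_pos _ X).le
      _ = Real.exp (2 * η * Fintype.card Λ) * K * (gaussWeight (1 : Matrix (Λ ⊕ C₀) (Λ ⊕ C₀) ℝ) X *
            (Real.exp (-(1 / 2 * ((Γ₀ *ᵥ X) ⬝ᵥ (C *ᵥ (Γ₀ *ᵥ X)))) + (2 * ρ + a) / 2 * (X ⬝ᵥ X))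
              * innerB C (2 * ρ + a) (Γ₀ *ᵥ X))) := by ring

/-! ## §4. The tree's separate-holomorphy class `SepHolOn` follows; the σ-slot of (2.14); the printed last line in τ -/

/-- **Joint holomorphy on a polydisc gives the tree's `SepHolOn`**: a function holomorphic (Fréchet) on the open set
`{σ : ι → ℂ | ∀ j, σ j ∈ U}` is holomorphic in each coordinate separately there (composition with the affine line
`z ↦ update p i z`). [cite: Balaban1988RG2Cluster, (2.14) p.15] (elementary API for (2.14)) -/
theorem sepHolOn_of_differentiableOn_pi {ι : Type*} [Fintype ι] [DecidableEq ι] {E : Type*} [NormedAddCommGroup E]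
    [NormedSpace ℂ E] {U : Set ℂ} {Φ : (ι → ℂ) → E} (hΦ : DifferentiableOn ℂ Φ {σ | ∀ j, σ j ∈ U}) :
    SepHolOn U Φ := by
  intro i p hp
  have hL : Differentiable ℂ (fun z : ℂ => Function.update p i z) := by
    refine differentiable_pi.2 fun j => ?_
    by_cases h : j = i
    · subst h; simp only [Function.update_self]; exact differentiable_id
    · simp only [Function.update_of_ne h]; exact differentiable_const _
  refine hΦ.comp hL.differentiableOn fun z hz j => ?_
  by_cases h : j = i
  · subst h; simpa using hz
  · simpa [Function.update_of_ne h] using hp j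

/-- **THE σ-SLOT `hΨσ` DERIVED**: for the (2.14)-data `A(σ)`, `Γ(σ)` on the parameter polydisc `U^ι` (open `U`) with the
hypotheses of `differentiableOn_core214X` there and a fixed last line `F(τ, ·)`, the function
`σ ↦ ∫dμ₀(X)|_Z (lines 2–4 of (2.14))` = `B13Term214.core214 A Γ F σ τ` is `SepHolOn U` — the hypothesis `hΨσ` of
`B13Term214.term214_eq_DopC` ∕ `B13Lemma3TorusPrimitive.h226_torus_of_primitives`, now a CONSEQUENCE of entrywise
holomorphy of the operator families and the (2.15)–(2.23) letters. [cite: Balaban1988RG2Cluster, (2.14)–(2.15) p.15, (2.16)–(2.22) p.16, (2.23) p.17] -/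
theorem sepHolOn_core214_sigma {ι : Type*} [Fintype ι] [DecidableEq ι] {D : Type*} {U : Set ℂ} (hU : IsOpen U)
    {Aσ : (ι → ℂ) → Matrix Λ Λ ℂ} {Γσ : (ι → ℂ) → (Λ ⊕ C₀ → ℝ) → (Λ → ℂ)} {Fτ : (D → ℂ) → (Λ → ℝ) → ℂ} (τ : D → ℂ)
    (hA : ∀ i j, DifferentiableOn ℂ (fun σ => Aσ σ i j) {σ | ∀ j, σ j ∈ U})
    (hAs : ∀ σ : ι → ℂ, (∀ j, σ j ∈ U) → (Aσ σ).IsSymm)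
    (hApos : ∀ σ : ι → ℂ, (∀ j, σ j ∈ U) → ((Aσ σ).map Complex.re).PosDef)
    (hΓd : ∀ (X : Λ ⊕ C₀ → ℝ) (i : Λ), DifferentiableOn ℂ (fun σ => Γσ σ X i) {σ | ∀ j, σ j ∈ U})
    (hΓc : ∀ σ : ι → ℂ, (∀ j, σ j ∈ U) → Continuous (Γσ σ))
    (hFm : StronglyMeasurable (Fτ τ))
    (hC : C.PosDef) (hρ0 : 0 ≤ ρ) (ha0 : 0 ≤ a) (hK : 0 ≤ K)
    (hR1 : ∀ σ : ι → ℂ, (∀ j, σ j ∈ U) → ∀ X : Λ ⊕ C₀ → ℝ, -(1 / 2) * ((Γσ σ X) ⬝ᵥ ((Aσ σ)⁻¹ *ᵥ Γσ σ X)).re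
      ≤ -(1 / 2 * ((Γ₀ *ᵥ X) ⬝ᵥ (C *ᵥ (Γ₀ *ᵥ X)))) + ρ / 2 * (X ⬝ᵥ X))
    (h17a : ∀ σ : ι → ℂ, (∀ j, σ j ∈ U) →
      Real.sqrt (‖(Aσ σ).det‖ / ((Aσ σ).map Complex.re).det) ≤ Real.exp (η * Fintype.card Λ))
    (h17b : ∀ σ : ι → ℂ, (∀ j, σ j ∈ U) →
      Real.sqrt (((Aσ σ).map Complex.re).det / C⁻¹.det) ≤ Real.exp (η * Fintype.card Λ))
    (hR2 : ∀ σ : ι → ℂ, (∀ j, σ j ∈ U) → ∀ B : Λ → ℝ, B ⬝ᵥ ((C⁻¹ - (Aσ σ).map Complex.re) *ᵥ B) ≤ ρ * (B ⬝ᵥ B))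
    (hR3 : ∀ σ : ι → ℂ, (∀ j, σ j ∈ U) → ∀ (X : Λ ⊕ C₀ → ℝ) (B : Λ → ℝ), -(B ⬝ᵥ fun i => (Γσ σ X i).re)
      ≤ -(B ⬝ᵥ (Γ₀ *ᵥ X)) + ρ / 2 * (X ⬝ᵥ X + B ⬝ᵥ B))
    (hF : ∀ B, ‖Fτ τ B‖ ≤ K * Real.exp (a / 2 * (B ⬝ᵥ B)))
    (hc0 : 0 ≤ c) (hc : ∀ k, hC.1.eigenvalues k ≤ c) (hαc : (2 * ρ + a) * c ≤ 1 / 2)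
    (hΓ0 : ∀ X : Λ ⊕ C₀ → ℝ, (Γ₀ *ᵥ X) ⬝ᵥ (C *ᵥ (Γ₀ *ᵥ X)) ≤ g * (X ⬝ᵥ X))
    (hsmall : (2 * ρ + a) * (1 + 2 * c * g) < 1) :
    SepHolOn U (fun σ => core214 Aσ Γσ Fτ σ τ) := by
  have hV : IsOpen {σ : ι → ℂ | ∀ j, σ j ∈ U} := by
    have e : {σ : ι → ℂ | ∀ j, σ j ∈ U} = Set.pi Set.univ (fun _ => U) := by ext σ; simp [Set.mem_pi]
    rw [e]; exact isOpen_set_pi Set.finite_univ fun _ _ => hU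
  refine sepHolOn_of_differentiableOn_pi ?_
  unfold core214
  exact differentiableOn_core214X hV hA (fun p hp => hAs p hp) (fun p hp => hApos p hp) hΓd
    (fun p hp => hΓc p hp) (fun B => differentiableOn_const (Fτ τ B)) (fun p _ => hFm) hC hρ0 ha0 hK
    (fun p hp => hR1 p hp) (fun p hp => h17a p hp) (fun p hp => h17b p hp) (fun p hp => hR2 p hp)
    (fun p hp => hR3 p hp) (fun p _ => hF) hc0 hc hαc hΓ0 hsmall

omit [Fintype Λ] [DecidableEq Λ] in
/-- **The printed last line is holomorphic in `τ`** at every field: `F(τ, B) = (−1)^{|P|}χ_{k,Y₀}(B)χᶜ_{k,P}(B)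
exp[Σ_{Y∈𝐃} τ(Y)𝐕_k(Y,B)]` (`B13Term214.F214`) is entire in `τ ∈ ℂ^𝐃` (finite `𝐃`-index; the τ-slot `hΨτ` is then `differentiableOn_core214X`
over `P = D → ℂ` with `A`, `Γ` constant and this last line, given the Gaussian growth (2.20) + (2.22) uniformly on the
τ-polydisc — `B13Integral223.norm_F214_le`). [cite: Balaban1988RG2Cluster, (2.14) p.15, (2.20)–(2.22) p.16] -/
theorem differentiableOn_F214 {D : Type*} [Fintype D] (cardP : ℕ) (χY₀ χcP : (Λ → ℝ) → ℝ) (Dfam : Finset D)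
    (Vk : D → (Λ → ℝ) → ℂ) (W : Set (D → ℂ)) (B : Λ → ℝ) :
    DifferentiableOn ℂ (fun τ => F214 cardP χY₀ χcP Dfam Vk τ B) W := by
  unfold F214
  have h : DifferentiableOn ℂ (fun τ : D → ℂ => ∑ Y ∈ Dfam, τ Y * Vk Y B) W :=
    DifferentiableOn.fun_sum fun Y _ =>
      (differentiable_apply (𝕜 := ℂ) Y).differentiableOn.mul (differentiableOn_const (Vk Y B))
  exact (differentiableOn_const ((-1 : ℂ) ^ cardP * (χY₀ B : ℂ) * (χcP B : ℂ))).mul h.cexp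

omit [Fintype Λ] [DecidableEq Λ] in
/-- The printed last line is measurable in the field when its ingredients are (characteristic functions, potentials).
[cite: Balaban1988RG2Cluster, (2.14) p.15] (elementary API for (2.14)) -/
theorem measurable_F214 {D : Type*} (cardP : ℕ) {χY₀ χcP : (Λ → ℝ) → ℝ} (hχm : Measurable χY₀) (hχcm : Measurable χcP)
    (Dfam : Finset D) {Vk : D → (Λ → ℝ) → ℂ} (hVm : ∀ Y, Measurable (Vk Y)) (τ : D → ℂ) :
    Measurable (F214 cardP χY₀ χcP Dfam Vk τ) := by
  unfold F214
  refine ((measurable_const.mul (Complex.measurable_ofReal.comp hχm)).mul (Complex.measurable_ofReal.comp hχcm)).mul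
    (Complex.measurable_exp.comp (Finset.measurable_sum _ fun Y _ => measurable_const.mul (hVm Y)))

/-- **THE τ-SLOT `hΨτ` DERIVED** for the printed last line: at a fixed `σ` (operators `A(σ)`, `Γ(σ)` fixed, with the
(2.15)–(2.23) letters at that `σ`), for `τ` in an open polydisc `Uτ^𝐃` on which the interaction obeys (2.20) UNIFORMLY
(`Σ_{Y∈𝐃}|τ(Y)||𝐕_k(Y,B)| ≤ ½a₂₀‖B‖² + w` — print: `|τ(Y)|` up to the radius `(2.18)⁻¹`) and the characteristic functions
obey (2.22), the function `τ ↦ ∫dμ₀(X)|_Z (lines 2–4 of (2.14))` = `core214 A Γ (F214 …) σ τ` is `SepHolOn Uτ` — the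
hypothesis `hΨτ` of `B13Term214.term214_eq_DopC` ∕ `B13Lemma3TorusPrimitive.h226_torus_of_primitives` as a CONSEQUENCE
(Gaussian growth of the last line by `B13Integral223.norm_F214_le` with `K = e^{−½γ₂r²|P| + w}`, `a = γ₂ + a₂₀`).
[cite: Balaban1988RG2Cluster, (2.14)–(2.15) p.15, (2.16)–(2.22) p.16, (2.23) p.17] -/
theorem sepHolOn_core214_tau {ι : Type*} {D : Type*} [Fintype D] [DecidableEq D] {Uτ : Set ℂ} (hU : IsOpen Uτ)
    {Aσ : (ι → ℂ) → Matrix Λ Λ ℂ} {Γσ : (ι → ℂ) → (Λ ⊕ C₀ → ℝ) → (Λ → ℂ)} (σ : ι → ℂ)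
    (hAs : (Aσ σ).IsSymm) (hApos : ((Aσ σ).map Complex.re).PosDef) (hΓc : Continuous (Γσ σ))
    (cardP : ℕ) {χY₀ χcP : (Λ → ℝ) → ℝ} (hχm : Measurable χY₀) (hχcm : Measurable χcP)
    (hχ0 : ∀ B, 0 ≤ χY₀ B) (hχc0 : ∀ B, 0 ≤ χcP B) (Dfam : Finset D) {Vk : D → (Λ → ℝ) → ℂ}
    (hVm : ∀ Y, Measurable (Vk Y)) {γ₂ rP a₂₀ w : ℝ} (qP : (Λ → ℝ) → ℝ)
    (h222 : ∀ B, χY₀ B * χcP B ≤ Real.exp (-(γ₂ / 2 * rP ^ 2 * cardP) + γ₂ / 2 * qP B)) (hγ₂ : 0 ≤ γ₂)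
    (hqP : ∀ B, qP B ≤ B ⬝ᵥ B) (ha₂₀ : 0 ≤ a₂₀)
    (h220U : ∀ τ : D → ℂ, (∀ Y, τ Y ∈ Uτ) → ∀ B, ∑ Y ∈ Dfam, ‖τ Y‖ * ‖Vk Y B‖ ≤ a₂₀ / 2 * (B ⬝ᵥ B) + w)
    (hC : C.PosDef) (hρ0 : 0 ≤ ρ)
    (hR1 : ∀ X : Λ ⊕ C₀ → ℝ, -(1 / 2) * ((Γσ σ X) ⬝ᵥ ((Aσ σ)⁻¹ *ᵥ Γσ σ X)).re
      ≤ -(1 / 2 * ((Γ₀ *ᵥ X) ⬝ᵥ (C *ᵥ (Γ₀ *ᵥ X)))) + ρ / 2 * (X ⬝ᵥ X))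
    (h17a : Real.sqrt (‖(Aσ σ).det‖ / ((Aσ σ).map Complex.re).det) ≤ Real.exp (η * Fintype.card Λ))
    (h17b : Real.sqrt (((Aσ σ).map Complex.re).det / C⁻¹.det) ≤ Real.exp (η * Fintype.card Λ))
    (hR2 : ∀ B : Λ → ℝ, B ⬝ᵥ ((C⁻¹ - (Aσ σ).map Complex.re) *ᵥ B) ≤ ρ * (B ⬝ᵥ B))
    (hR3 : ∀ (X : Λ ⊕ C₀ → ℝ) (B : Λ → ℝ), -(B ⬝ᵥ fun i => (Γσ σ X i).re)
      ≤ -(B ⬝ᵥ (Γ₀ *ᵥ X)) + ρ / 2 * (X ⬝ᵥ X + B ⬝ᵥ B))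
    (hc0 : 0 ≤ c) (hc : ∀ k, hC.1.eigenvalues k ≤ c) (hαc : (2 * ρ + (γ₂ + a₂₀)) * c ≤ 1 / 2)
    (hΓ0 : ∀ X : Λ ⊕ C₀ → ℝ, (Γ₀ *ᵥ X) ⬝ᵥ (C *ᵥ (Γ₀ *ᵥ X)) ≤ g * (X ⬝ᵥ X))
    (hsmall : (2 * ρ + (γ₂ + a₂₀)) * (1 + 2 * c * g) < 1) :
    SepHolOn Uτ (fun τ => core214 Aσ Γσ (F214 cardP χY₀ χcP Dfam Vk) σ τ) := by
  have hV : IsOpen {τ : D → ℂ | ∀ Y, τ Y ∈ Uτ} := by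
    have e : {τ : D → ℂ | ∀ Y, τ Y ∈ Uτ} = Set.pi Set.univ (fun _ => Uτ) := by ext τ; simp [Set.mem_pi]
    rw [e]; exact isOpen_set_pi Set.finite_univ fun _ _ => hU
  refine sepHolOn_of_differentiableOn_pi ?_
  unfold core214
  refine differentiableOn_core214X (A := fun _ => Aσ σ) (Γ := fun _ => Γσ σ)
    (F := fun τ => F214 cardP χY₀ χcP Dfam Vk τ) (K := Real.exp (-(γ₂ / 2 * rP ^ 2 * cardP) + w)) hV (fun i j => differentiableOn_const _) (fun _ _ => hAs)
    (fun _ _ => hApos) (fun X i => differentiableOn_const _) (fun _ _ => hΓc)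
    (fun B => differentiableOn_F214 cardP χY₀ χcP Dfam Vk _ B)
    (fun τ _ => (measurable_F214 cardP hχm hχcm Dfam hVm τ).stronglyMeasurable) hC hρ0 (by positivity)
    (Real.exp_pos _).le (fun _ _ => hR1) (fun _ _ => h17a) (fun _ _ => h17b) (fun _ _ => hR2) (fun _ _ => hR3)
    (fun τ hτ B => ?_) hc0 hc hαc hΓ0 hsmall
  exact B13Integral223.norm_F214_le cardP χY₀ χcP Dfam Vk τ qP B (hχ0 B) (hχc0 B) (h222 B) hγ₂ (hqP B) (h220U τ hτ B)

end Literature.MathematicalPhysics.QuantumFieldTheory.Balaban1983to89.B13Core214Holomorphic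

end
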